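import Summits.ResolutionOfSingularities.ResolutionOfSingularities.Theorems.EquisingularLiftEquisingularLiftNatFanGameWinnable
import HarnessLib

/-!
# [OURS · L1 W4.5(b) · EL♮(3) · D-0157 DOOR 1, WIDTH row iso-w4] FAN-GAME WINNABILITY IN EVERY DIMENSION — brick α1:
# the DIMENSION-FREE ONE-WALL ENGINE and the binomial tables `{a, b}` for ALL `n`

res-L1-w45b-iso-w4 g2 (prover, width seat, free hand; desk WIDTH TABLE D1/D1′ row iso-w4 «FAN-GAME WINNABILITY, n = 3 first» —
this is the `n`-free half; Q-w4 STATUS 2026-08-28T17:52Z).  `--kind proof --supports stmt-ResolutionOfSingularities-20148 --as helper`.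
Def-free, sorry-free, fact-free.  OURS; counted 0; AI kernel work, weaker than expert review; NOT a statement of any manuscript;
nothing of [Hironaka2017] is used; resolution of singularities in characteristic `p` is NOT proved here or anywhere in this chain.

## What is proved (all `n`, every position — no bound on the number of rays of a cone)

* `FanGame.reach_clear_ray` — ONE RAY IS CLEARED: if `ℓ = ⟨·, z⟩` has value `M > 0` at the ray `p` and `≥ −M` on every ray adjacent
  to `p`, then starring, one after the other, the crossing edges `{p, q}` (`ℓ q < 0`, `q` adjacent to `p`) reaches a position in which
  NO cone through `p` has a negative ray; every ray of a crossing cone of the new position is a ray of a crossing cone of the old one or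
  has `|ℓ| < M`.  Measure: the number of negative rays adjacent to `p` — the star at `{p, q}` removes `q` from the link of `p` and adds
  only `p + q`, of value `M + ℓ q ∈ [0, M)`.
* `FanGame.reach_signConstant_all` — THE DIMENSION-FREE ONE-WALL ENGINE: `V` any table, `z` any integer vector such that every cone on
  which `ℓ` takes both signs is `Bad` for `V` (E1-legality of the stars), `F` ANY position: some `Reach V F F'` has `ℓ` of constant sign
  on every cone.  Measure: (`M` = max `|ℓ|` over the rays of crossing cones, number of such rays with `|ℓ| = M`) lexicographic — clearing a
  ray of absolute value `M` (by `reach_clear_ray` for `z` or `−z`) removes it from the crossing cones and creates only rays of `|ℓ| < M`.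
  (g0's engine `reach_signConstant` needs `card σ ≤ 3`: its measure `Σ 3^{(Σ⁺)(Σ⁻)}` is false for four rays.)
* `FanGame.reach_won_pair_all`, ★ `FanGame.fanGameWinnable_pair_all` — EVERY BINOMIAL TABLE `{a, b}` (the monomial ideal `(xᵃ, xᵇ)`)
  IS WINNABLE from every position, in every dimension `n`: E1-legal toric principalisation of binomial monomial ideals.

Geometric reading: along the blow-ups of the torus-invariant centres `V(τ)`, `τ = {p, q}` a crossing edge, the binomial ideal
`(xᵃ, xᵇ)` — non-principal exactly along the `V(τ)` with `τ` crossing — becomes principal; the schedule is De Concini–Procesi's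
one-hyperplane step [Ewald 1996, VI.7] run ray by ray, which is what makes it E1-legal and dimension-free.

NOT proved here: tables with `≥ 3` exponents for `n ≥ 4` (`n = 3`: ✓ p648479 `fanGameWinnable_three`).
-/

set_option linter.dupNamespace false

namespace Summit.ResolutionOfSingularities.ResolutionOfSingularities.Cruxes.EquisingularLiftNat.Sections

namespace FanGame

variable {n : ℕ}

/-! ### Membership in the star at an edge -/

/-- The cones of `star F {p, q}` (`p ≠ q`): the old cones not containing both `p` and `q`, and, for every old cone `σ ∋ p, q`, the two
children `insert (p + q) (σ.erase p)` and `insert (p + q) (σ.erase q)`. -/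
theorem mem_star_pair {F : Finset (Finset (Ray n))} {p q : Ray n} (hpq : p ≠ q) {C : Finset (Ray n)} :
    C ∈ star F ({p, q} : Finset (Ray n)) ↔
      (C ∈ F ∧ ¬ (p ∈ C ∧ q ∈ C)) ∨
        ∃ σ ∈ F, p ∈ σ ∧ q ∈ σ ∧ (C = insert (p + q) (σ.erase p) ∨ C = insert (p + q) (σ.erase q)) := by
  classical
  have hsum : ∑ ρ ∈ ({p, q} : Finset (Ray n)), ρ = p + q := Finset.sum_pair hpq
  have hsub : ∀ σ : Finset (Ray n), ({p, q} : Finset (Ray n)) ⊆ σ ↔ p ∈ σ ∧ q ∈ σ := fun σ => by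
    rw [Finset.insert_subset_iff, Finset.singleton_subset_iff]
  simp only [star, Finset.mem_union, Finset.mem_filter, Finset.mem_biUnion, Finset.mem_image, hsub, hsum,
    Finset.mem_insert, Finset.mem_singleton]
  constructor
  · rintro (⟨hC, hn⟩ | ⟨σ, ⟨hσ, hp, hq⟩, t, ht, rfl⟩)
    · exact Or.inl ⟨hC, hn⟩
    · rcases ht with rfl | rfl
      · exact Or.inr ⟨σ, hσ, hp, hq, Or.inl rfl⟩
      · exact Or.inr ⟨σ, hσ, hp, hq, Or.inr rfl⟩
  · rintro (⟨hC, hn⟩ | ⟨σ, hσ, hp, hq, rfl | rfl⟩)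
    · exact Or.inl ⟨hC, hn⟩
    · exact Or.inr ⟨σ, ⟨hσ, hp, hq⟩, p, Or.inl rfl, rfl⟩
    · exact Or.inr ⟨σ, ⟨hσ, hp, hq⟩, q, Or.inr rfl, rfl⟩

/-- One legal star at a crossing edge `{p, q}` of a cone `σ₀ ∈ F`. -/
theorem reach_star_pair (V : Finset (Fin n → ℕ)) (z : Fin n → ℤ) (hBad : ∀ τ : Finset (Ray n), Crossing z τ → Bad V τ)
    {F : Finset (Finset (Ray n))} {σ₀ : Finset (Ray n)} (hσ₀ : σ₀ ∈ F) {p q : Ray n} (hp : p ∈ σ₀) (hq : q ∈ σ₀)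
    (hp0 : 0 < lin z p) (hq0 : lin z q < 0) : Reach V F (star F ({p, q} : Finset (Ray n))) := by
  have hτσ₀ : ({p, q} : Finset (Ray n)) ⊆ σ₀ := by
    rw [Finset.insert_subset_iff, Finset.singleton_subset_iff]; exact ⟨hp, hq⟩
  exact Reach.step F F {p, q} σ₀ (Reach.refl F) hσ₀ hτσ₀ ⟨p, Finset.mem_insert_self _ _⟩
    (hBad _ ⟨⟨p, Finset.mem_insert_self _ _, hp0⟩, ⟨q, Finset.mem_insert_of_mem (Finset.mem_singleton_self _), hq0⟩⟩)

/-! ### Clearing one ray -/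

/-- **ONE RAY IS CLEARED** (any `n`, any position).  `ℓ = ⟨·, z⟩`, `ℓ p = M > 0`, and `ℓ ≥ −M` on the rays of the cones through `p`.
Then some E1-legal continuation (stars at crossing edges `{p, q}` only) reaches a position in which no cone through `p` has a negative
ray, and every ray of a crossing cone of which is a ray of a crossing cone of `F` or has `|ℓ| < M`.  Induction on the number of negative
rays adjacent to `p`. [OURS · L1 W4.5b · row iso-w4, brick α1] -/
theorem reach_clear_ray (V : Finset (Fin n → ℕ)) (z : Fin n → ℤ) (hBad : ∀ τ : Finset (Ray n), Crossing z τ → Bad V τ)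
    (p : Ray n) (M : ℤ) (hpM : lin z p = M) (hM : 0 < M) :
    ∀ F : Finset (Finset (Ray n)), (∀ σ ∈ F, p ∈ σ → ∀ u ∈ σ, -M ≤ lin z u) →
      ∃ F', Reach V F F' ∧ (∀ σ ∈ F', p ∈ σ → ∀ u ∈ σ, 0 ≤ lin z u) ∧
        ∀ C ∈ F', Crossing z C → ∀ u ∈ C, (∃ σ ∈ F, Crossing z σ ∧ u ∈ σ) ∨ |lin z u| < M := by
  classical
  -- the negative rays adjacent to `p`
  let negAdj : Finset (Finset (Ray n)) → Finset (Ray n) := fun F =>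
    ((F.filter (fun σ => p ∈ σ)).biUnion id).filter (fun u => lin z u < 0)
  have mem_negAdj : ∀ (F : Finset (Finset (Ray n))) (u : Ray n),
      u ∈ negAdj F ↔ (∃ σ ∈ F, p ∈ σ ∧ u ∈ σ) ∧ lin z u < 0 := by
    intro F u
    simp only [negAdj, Finset.mem_filter, Finset.mem_biUnion, id, and_assoc]
  suffices H : ∀ (N : ℕ) (F : Finset (Finset (Ray n))), (negAdj F).card ≤ N →
      (∀ σ ∈ F, p ∈ σ → ∀ u ∈ σ, -M ≤ lin z u) →
      ∃ F', Reach V F F' ∧ (∀ σ ∈ F', p ∈ σ → ∀ u ∈ σ, 0 ≤ lin z u) ∧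
        ∀ C ∈ F', Crossing z C → ∀ u ∈ C, (∃ σ ∈ F, Crossing z σ ∧ u ∈ σ) ∨ |lin z u| < M from
    fun F hF => H _ F le_rfl hF
  -- if no negative ray is adjacent to `p`, the position itself will do
  have done : ∀ F : Finset (Finset (Ray n)), negAdj F = ∅ →
      ∃ F', Reach V F F' ∧ (∀ σ ∈ F', p ∈ σ → ∀ u ∈ σ, 0 ≤ lin z u) ∧
        ∀ C ∈ F', Crossing z C → ∀ u ∈ C, (∃ σ ∈ F, Crossing z σ ∧ u ∈ σ) ∨ |lin z u| < M := by
    intro F h0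
    refine ⟨F, Reach.refl F, fun σ hσ hpσ u hu => ?_, fun C hC hCx u hu => Or.inl ⟨C, hC, hCx, hu⟩⟩
    by_contra hneg
    have : u ∈ negAdj F := (mem_negAdj F u).2 ⟨⟨σ, hσ, hpσ, hu⟩, not_le.1 hneg⟩
    rw [h0] at this
    exact Finset.notMem_empty u this
  intro N
  induction N with
  | zero =>
    intro F hN hF
    exact done F (Finset.card_eq_zero.1 (Nat.le_zero.1 hN))
  | succ N ih =>
    intro F hN hF
    by_cases h0 : negAdj F = ∅
    · exact done F h0
    obtain ⟨q, hqN⟩ := Finset.nonempty_iff_ne_empty.2 h0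
    obtain ⟨⟨σ₀, hσ₀, hp, hq⟩, hq0⟩ := (mem_negAdj F q).1 hqN
    have hp0 : 0 < lin z p := hpM ▸ hM
    have hpq : p ≠ q := by rintro rfl; exact lt_irrefl _ (hq0.trans hp0)
    have hqM : -M ≤ lin z q := hF σ₀ hσ₀ hp q hq
    have hr0 : 0 ≤ lin z (p + q) := by rw [lin_add]; linarith
    have hrM : |lin z (p + q)| < M := by rw [lin_add, abs_lt]; constructor <;> linarith
    have hrp : p ≠ p + q := by
      intro h; have := congrArg (lin z) h; rw [lin_add] at this; linarith
    -- the star at `{p, q}`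
    set F₁ := star F ({p, q} : Finset (Ray n)) with hF₁
    have hR₁ : Reach V F F₁ := reach_star_pair V z hBad hσ₀ hp hq hp0 hq0
    -- cones of `F₁` through `p`
    have through_p : ∀ C ∈ F₁, p ∈ C → (C ∈ F ∧ q ∉ C) ∨ ∃ σ ∈ F, p ∈ σ ∧ q ∈ σ ∧ C = insert (p + q) (σ.erase q) := by
      intro C hC hpC
      rcases (mem_star_pair hpq).1 hC with ⟨hCF, hn⟩ | ⟨σ, hσ, hpσ, hqσ, rfl | rfl⟩
      · exact Or.inl ⟨hCF, fun hqC => hn ⟨hpC, hqC⟩⟩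
      · exfalso
        rcases Finset.mem_insert.1 hpC with h | h
        · exact hrp h
        · exact Finset.notMem_erase p σ h
      · exact Or.inr ⟨σ, hσ, hpσ, hqσ, rfl⟩
    -- the hypothesis persists
    have hF₁M : ∀ σ ∈ F₁, p ∈ σ → ∀ u ∈ σ, -M ≤ lin z u := by
      intro C hC hpC u hu
      rcases through_p C hC hpC with ⟨hCF, -⟩ | ⟨σ, hσ, hpσ, -, rfl⟩
      · exact hF C hCF hpC u hu
      · rcases Finset.mem_insert.1 hu with rfl | hu'
        · linarith
        · exact hF σ hσ hpσ u (Finset.mem_of_mem_erase hu')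
    -- the measure drops: `q` leaves the link of `p`, only `p + q ≥ 0` enters
    have hsub : negAdj F₁ ⊆ (negAdj F).erase q := by
      intro u hu
      obtain ⟨⟨C, hC, hpC, huC⟩, hu0⟩ := (mem_negAdj F₁ u).1 hu
      rw [Finset.mem_erase, mem_negAdj]
      rcases through_p C hC hpC with ⟨hCF, hqC⟩ | ⟨σ, hσ, hpσ, hqσ, rfl⟩
      · exact ⟨fun h => hqC (h ▸ huC), ⟨C, hCF, hpC, huC⟩, hu0⟩
      · rcases Finset.mem_insert.1 huC with rfl | hu'
        · exact absurd hu0 (not_lt.2 hr0)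
        · exact ⟨Finset.ne_of_mem_erase hu', ⟨σ, hσ, hpσ, Finset.mem_of_mem_erase hu'⟩, hu0⟩
    have hN₁ : (negAdj F₁).card ≤ N := by
      have h1 := Finset.card_le_card hsub
      have h2 := Finset.card_erase_of_mem hqN
      omega
    obtain ⟨F', hR', hP', hC'⟩ := ih F₁ hN₁ hF₁M
    refine ⟨F', reach_trans V hR' hR₁, hP', fun C hC hCx u hu => ?_⟩
    rcases hC' C hC hCx u hu with ⟨σ₁, hσ₁, hσ₁x, huσ₁⟩ | hsmall
    · -- a crossing cone of `F₁`: an old cone, or a child of an old cone through `p, q` (which is crossing)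
      rcases (mem_star_pair hpq).1 hσ₁ with ⟨hσ₁F, -⟩ | ⟨σ, hσ, hpσ, hqσ, hch⟩
      · exact Or.inl ⟨σ₁, hσ₁F, hσ₁x, huσ₁⟩
      · have hσx : Crossing z σ := ⟨⟨p, hpσ, hp0⟩, ⟨q, hqσ, hq0⟩⟩
        have hu' : u = p + q ∨ u ∈ σ := by
          rcases hch with rfl | rfl
          · rcases Finset.mem_insert.1 huσ₁ with h | h
            · exact Or.inl h
            · exact Or.inr (Finset.mem_of_mem_erase h)
          · rcases Finset.mem_insert.1 huσ₁ with h | h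
            · exact Or.inl h
            · exact Or.inr (Finset.mem_of_mem_erase h)
        rcases hu' with rfl | huσ
        · exact Or.inr hrM
        · exact Or.inl ⟨σ, hσ, hσx, huσ⟩
    · exact Or.inr hsmall

/-- **ONE RAY IS CLEARED, absolute form** (either sign): `|ℓ p| = M > 0` and `|ℓ| ≤ M` on the rays of the crossing cones of `F`; then some
E1-legal continuation puts `p` outside every crossing cone, creating only rays of `|ℓ| < M` (apply `reach_clear_ray` to `z` or to `−z`).
[OURS · L1 W4.5b · row iso-w4, brick α1] -/
theorem reach_clear_ray_abs (V : Finset (Fin n → ℕ)) (z : Fin n → ℤ) (hBad : ∀ τ : Finset (Ray n), Crossing z τ → Bad V τ)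
    (p : Ray n) (M : ℕ) (hpM : |lin z p| = M) (hM : 0 < M) (F : Finset (Finset (Ray n)))
    (hF : ∀ σ ∈ F, Crossing z σ → ∀ u ∈ σ, |lin z u| ≤ M) :
    ∃ F', Reach V F F' ∧ (∀ σ ∈ F', p ∈ σ → ¬ Crossing z σ) ∧
      ∀ C ∈ F', Crossing z C → ∀ u ∈ C, (∃ σ ∈ F, Crossing z σ ∧ u ∈ σ) ∨ |lin z u| < M := by
  have hM' : (0 : ℤ) < M := by exact_mod_cast hM
  rcases lt_trichotomy (lin z p) 0 with hneg | h0 | hpos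
  · -- `ℓ p < 0`: clear `p` for `-z`
    have hpM' : lin (-z) p = M := by rw [lin_neg, ← hpM, abs_of_neg hneg]
    have hBad' : ∀ τ : Finset (Ray n), Crossing (-z) τ → Bad V τ := fun τ h => hBad τ ((crossing_neg_iff z τ).1 h)
    have hyp : ∀ σ ∈ F, p ∈ σ → ∀ u ∈ σ, -(M : ℤ) ≤ lin (-z) u := by
      intro σ hσ hpσ u hu
      rw [lin_neg]
      by_cases hx : Crossing z σ
      · have := hF σ hσ hx u hu; rw [abs_le] at this; linarith
      · have : ¬ (0 < lin z u) := fun h => hx ⟨⟨u, hu, h⟩, ⟨p, hpσ, hneg⟩⟩; linarith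
    obtain ⟨F', hR, hP, hC'⟩ := reach_clear_ray V (-z) hBad' p M hpM' hM' F hyp
    refine ⟨F', hR, fun σ hσ hpσ hx => ?_, fun C hC hCx u hu => ?_⟩
    · obtain ⟨⟨u, hu, hu0⟩, -⟩ := hx
      have := hP σ hσ hpσ u hu; rw [lin_neg] at this; linarith
    · rcases hC' C hC ((crossing_neg_iff z C).2 hCx) u hu with ⟨σ, hσ, hσx, huσ⟩ | h
      · exact Or.inl ⟨σ, hσ, (crossing_neg_iff z σ).1 hσx, huσ⟩
      · rw [lin_neg, abs_neg] at h; exact Or.inr h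
  · -- `ℓ p = 0` contradicts `|ℓ p| = M > 0`
    exfalso; rw [h0, abs_zero] at hpM; linarith
  · -- `ℓ p > 0`: clear `p` for `z`
    have hpM' : lin z p = M := by rw [← hpM, abs_of_pos hpos]
    have hyp : ∀ σ ∈ F, p ∈ σ → ∀ u ∈ σ, -(M : ℤ) ≤ lin z u := by
      intro σ hσ hpσ u hu
      by_cases hx : Crossing z σ
      · have := hF σ hσ hx u hu; rw [abs_le] at this; linarith
      · have : ¬ (lin z u < 0) := fun h => hx ⟨⟨p, hpσ, hpos⟩, ⟨u, hu, h⟩⟩; linarith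
    obtain ⟨F', hR, hP, hC⟩ := reach_clear_ray V z hBad p M hpM' hM' F hyp
    refine ⟨F', hR, fun σ hσ hpσ hx => ?_, hC⟩
    obtain ⟨-, ⟨u, hu, hu0⟩⟩ := hx
    have := hP σ hσ hpσ u hu; linarith

/-! ### The dimension-free one-wall engine -/

/-- **THE DIMENSION-FREE ONE-WALL ENGINE.**  `V` any table, `z` any integer vector such that every cone on which `⟨·, z⟩` takes both signs
is `Bad` for `V` (so that every star below is E1-LEGAL), `F` ANY position (any `n`, any number of rays per cone).  Then some E1-legal
continuation `Reach V F F'` reaches a position on every cone of which `⟨·, z⟩` has constant sign.  Measure: (`M` = the maximum of `|ℓ|`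
over the rays of the crossing cones, the number of such rays with `|ℓ| = M`), lexicographic; one application of `reach_clear_ray_abs`
lowers it. [OURS · L1 W4.5b · row iso-w4, brick α1] -/
theorem reach_signConstant_all (V : Finset (Fin n → ℕ)) (z : Fin n → ℤ) (hBad : ∀ τ : Finset (Ray n), Crossing z τ → Bad V τ)
    (F : Finset (Finset (Ray n))) : ∃ F', Reach V F F' ∧ ∀ σ ∈ F', ¬ Crossing z σ := by
  classical
  -- the rays of the crossing cones, and those of absolute value `M`
  let B : Finset (Finset (Ray n)) → Finset (Ray n) := fun F => (F.filter (fun σ => Crossing z σ)).biUnion id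
  have memB : ∀ (F : Finset (Finset (Ray n))) (u : Ray n), u ∈ B F ↔ ∃ σ ∈ F, Crossing z σ ∧ u ∈ σ := by
    intro F u; simp only [B, Finset.mem_filter, Finset.mem_biUnion, id, and_assoc]
  let top : ℕ → Finset (Finset (Ray n)) → Finset (Ray n) := fun M F => (B F).filter (fun u => |lin z u| = M)
  have mem_top : ∀ (M : ℕ) (F : Finset (Finset (Ray n))) (u : Ray n),
      u ∈ top M F ↔ (∃ σ ∈ F, Crossing z σ ∧ u ∈ σ) ∧ |lin z u| = M := by
    intro M F u; rw [Finset.mem_filter, memB]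
  suffices H : ∀ (M K : ℕ) (F : Finset (Finset (Ray n))),
      (∀ σ ∈ F, Crossing z σ → ∀ u ∈ σ, |lin z u| ≤ M) → (top M F).card ≤ K →
      ∃ F', Reach V F F' ∧ ∀ σ ∈ F', ¬ Crossing z σ by
    refine H ((B F).sup (fun u => (lin z u).natAbs)) _ F (fun σ hσ hx u hu => ?_) le_rfl
    have h1 : (lin z u).natAbs ≤ (B F).sup (fun u => (lin z u).natAbs) :=
      Finset.le_sup (f := fun u => (lin z u).natAbs) ((memB F u).2 ⟨σ, hσ, hx, hu⟩)
    rw [Int.abs_eq_natAbs]; exact_mod_cast h1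
  intro M
  induction M with
  | zero =>
    intro K F hB _
    refine ⟨F, Reach.refl F, fun σ hσ hx => ?_⟩
    obtain ⟨⟨u, hu, hu0⟩, -⟩ := id hx
    have h1 := hB σ hσ hx u hu
    rw [Nat.cast_zero, abs_of_pos hu0] at h1
    linarith
  | succ M ihM =>
    -- when no ray of a crossing cone has `|ℓ| = M + 1`, the bound `M` holds
    have drop : ∀ F : Finset (Finset (Ray n)), (∀ σ ∈ F, Crossing z σ → ∀ u ∈ σ, |lin z u| ≤ (M + 1 : ℕ)) →
        top (M + 1) F = ∅ → ∃ F', Reach V F F' ∧ ∀ σ ∈ F', ¬ Crossing z σ := by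
      intro F hB h0
      refine ihM _ F (fun σ hσ hx u hu => ?_) le_rfl
      have h1 := hB σ hσ hx u hu
      have h2 : |lin z u| ≠ (M + 1 : ℕ) := fun h => by
        have : u ∈ top (M + 1) F := (mem_top (M + 1) F u).2 ⟨⟨σ, hσ, hx, hu⟩, h⟩
        rw [h0] at this; exact Finset.notMem_empty u this
      have h3 := lt_of_le_of_ne h1 h2
      push_cast at h3
      exact Int.lt_add_one_iff.1 h3
    intro K
    induction K with
    | zero =>
      intro F hB hK
      exact drop F hB (Finset.card_eq_zero.1 (Nat.le_zero.1 hK))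
    | succ K ihK =>
      intro F hB hK
      by_cases h0 : top (M + 1) F = ∅
      · exact drop F hB h0
      obtain ⟨p, hpT⟩ := Finset.nonempty_iff_ne_empty.2 h0
      obtain ⟨-, hpM⟩ := (mem_top (M + 1) F p).1 hpT
      obtain ⟨F₁, hR₁, hP₁, hC₁⟩ := reach_clear_ray_abs V z hBad p (M + 1) hpM (Nat.succ_pos M) F hB
      -- the bound persists and `p` has left the crossing cones
      have hB₁ : ∀ σ ∈ F₁, Crossing z σ → ∀ u ∈ σ, |lin z u| ≤ (M + 1 : ℕ) := by
        intro C hC hCx u hu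
        rcases hC₁ C hC hCx u hu with ⟨σ, hσ, hσx, huσ⟩ | h
        · exact hB σ hσ hσx u huσ
        · exact h.le
      have hsub : top (M + 1) F₁ ⊆ (top (M + 1) F).erase p := by
        intro u hu
        obtain ⟨⟨C, hC, hCx, huC⟩, huM⟩ := (mem_top (M + 1) F₁ u).1 hu
        rw [Finset.mem_erase, mem_top]
        rcases hC₁ C hC hCx u huC with ⟨σ, hσ, hσx, huσ⟩ | h
        · refine ⟨?_, ⟨σ, hσ, hσx, huσ⟩, huM⟩
          rintro rfl
          exact hP₁ C hC huC hCx
        · exact absurd huM (ne_of_lt h)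
      have hK₁ : (top (M + 1) F₁).card ≤ K := by
        have h1 := Finset.card_le_card hsub
        have h2 := Finset.card_erase_of_mem hpT
        omega
      obtain ⟨F', hR', hW'⟩ := ihK F₁ hB₁ hK₁
      exact ⟨F', reach_trans V hR' hR₁, hW'⟩

/-! ### The binomial corollary, every dimension -/

/-- **BINOMIAL TABLES ARE WINNABLE FROM EVERY POSITION, IN EVERY DIMENSION**: for the table `{a, b}` (the monomial ideal `(xᵃ, xᵇ)`) and
ANY position `F`, some E1-legal continuation `Reach {a, b} F F'` wins (`Bad` for `{a, b}` IS «`⟨·, a⟩ − ⟨·, b⟩` takes both signs»,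
g0's `bad_pair_of_crossing` / `not_bad_pair_of_not_crossing`). [OURS · L1 W4.5b · row iso-w4, brick α1] -/
theorem reach_won_pair_all (a b : Fin n → ℕ) (F : Finset (Finset (Ray n))) :
    ∃ F', Reach ({a, b} : Finset (Fin n → ℕ)) F F' ∧ Won ({a, b} : Finset (Fin n → ℕ)) F' := by
  obtain ⟨F', hR, hW⟩ := reach_signConstant_all ({a, b} : Finset (Fin n → ℕ)) (fun i => (a i : ℤ) - b i)
    (fun τ hτ => bad_pair_of_crossing a b hτ) F
  exact ⟨F', hR, fun σ hσ => not_bad_pair_of_not_crossing a b (hW σ hσ)⟩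

/-- ★ **THE FAN GAME OF EVERY TWO-ELEMENT TABLE IS WINNABLE FROM THE ORTHANT, IN EVERY DIMENSION `n`** — E1-legal toric
principalisation of the binomial monomial ideal `(xᵃ, xᵇ) ⊆ k[x₁, …, xₙ]`: blowing up only torus-invariant centres along which the ideal is
not principal, one reaches a position where it is principal on every chart. [OURS · L1 W4.5b · row iso-w4, brick α1] -/
theorem fanGameWinnable_pair_all (a b : Fin n → ℕ) :
    ∃ F', Reach ({a, b} : Finset (Fin n → ℕ)) (orthantFan n) F' ∧ Won ({a, b} : Finset (Fin n → ℕ)) F' :=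
  reach_won_pair_all a b (orthantFan n)

/-- The `FanGameLocal`-shape statement for two-element tables, every `n`: from every position REACHABLE from the orthant, some E1-legal
continuation wins. [OURS · L1 W4.5b · row iso-w4, brick α1] -/
theorem reach_won_pair_of_reach_orthant (a b : Fin n → ℕ) {F : Finset (Finset (Ray n))}
    (_hF : Reach ({a, b} : Finset (Fin n → ℕ)) (orthantFan n) F) :
    ∃ F', Reach ({a, b} : Finset (Fin n → ℕ)) F F' ∧ Won ({a, b} : Finset (Fin n → ℕ)) F' :=
  reach_won_pair_all a b F

end FanGame

end Summit.ResolutionOfSingularities.ResolutionOfSingularities.Cruxes.EquisingularLiftNat.Sections
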